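import Summits.HodgeConjecture.HodgeConjecture.Theorems.F0P2pK1wHolds                     -- ★ (this seat): `cmPrincipalSeries_isConstituentOf_weylConj_holds` — K1w #98 hypothesis-free
import Summits.HodgeConjecture.HodgeConjecture.Theorems.F0P2oU1LetterOfTower               -- ★ p829230 (B-p18 (g28)): `u1ThetaDichotomy_nonsplit_of_uniqueSub (hN3) (h4)`
import Summits.HodgeConjecture.HodgeConjecture.Theorems.F0P2pPrincipalSeriesUniqueSubCM      -- ★ p832406: road (T) step (4) CM head `principalSeries_uniqueSub (hN1)`
import Summits.HodgeConjecture.HodgeConjecture.Theorems.F0P2oGR91NOfLetters                  -- ★ p828472 (B-p14 (g27)): `GR91N_of_letters (hN3) (hW) (hU1)`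
import Summits.HodgeConjecture.HodgeConjecture.Theorems.F0P2oThetaInPSOfLetters              -- ★ p828142 (B-p18 (g28)): `stubThetaInPS_of_letters (hN3) (hW) (hU1)`
import HarnessLib

/-!
# Crux `H413`, programme P2, pay-down line `F0_P2GR91NJacquet` — THE LINE MODULO ONE PRINT LETTER: U1, K1 and #76 (GR91 Lemma 5.1.2, non-split) FROM N3 ALONE

Cell hodgecm-mathlib (D-0151), FLOOR 0, crux item H413 = stmt-HodgeConjecture-24833; pay-down line `Cruxes/H413/Lines/F0_P2GR91NJacquet.lean`
(v1.2) and its K1 sub-line `Lines/F0_P2GR91NJacquetK1.lean` (v3c), whose open stubs are the three PRINT letters `stub_N3_letter`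
(★ `GelbartRogawski1991.thetaType_nonsplit_jacquetModule`, #96), `stub_K1w_letter` (★ `Rogawski1990.cmPrincipalSeries_isConstituentOf_weylConj`,
#98) and `stub_U1_letter` (★ `GelbartRogawski1991.u1ThetaDichotomy_nonsplit`, #97); the PKΠ line folds `stub_GR91N := F0P2oGR91NOfLetters.GR91N_of_letters
stub_N3_letter stub_K1w_letter stub_U1_letter` (#76 ⟸ {N3, K1w, U1}).

After tonight's landings TWO of the three letters are theorems of the tree modulo nothing but N3:
* K1w is HYPOTHESIS-FREE — ★ `F0P2pK1wHolds.cmPrincipalSeries_isConstituentOf_weylConj_holds` (K1w ⟸ N1 ★ p832032, N1 ★ p832625 ∕ p831847);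
* U1 ⟸ {N3, N1} — ★ `F0P2oU1LetterOfTower.u1ThetaDichotomy_nonsplit_of_uniqueSub (hN3) (h4)` (road (T), B-p18 (g28) ∕ A-p12 ∕ F0P2-p05 ∕ F0P2-p01) with
  `h4` = ★ `F0P2pPrincipalSeriesUniqueSubCM.principalSeries_uniqueSub (hN1)` (sub-uniqueness of `i_G(χ)`, `χ ≠ wχ`) and N1 hypothesis-free.

THIS FILE records the three compositions, each CONDITIONAL on the ONE print letter N3 taken BY NAME as the hypothesis `hN3`
([GelbartRogawski1991 §3.2 (3.2.1)–(3.2.2) p. 457; Kudla1986 Thm. 2.8] — the Jacquet module of the local theta type along the Borel at a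
non-split place; road in progress on the A∕B benches):
* §1 **`u1ThetaDichotomy_nonsplit_of_N3 (hN3) : GelbartRogawski1991.u1ThetaDichotomy_nonsplit`** — U1 (#97) ⟸ N3;
* §2 **`stubThetaInPS_of_N3 (hN3) : ‹StubThetaInPS body›`** — the registered stub K1 of the parent line ⟸ N3 (statement = ★
  `F0P2oThetaInPSOfLetters.stubThetaInPS_of_letters`'s conclusion VERBATIM);
* §3 **`GR91Lemma512NonsplitAsPrinted_of_N3 (hN3) : GelbartRogawski1991.GR91Lemma512NonsplitAsPrinted`** — print letter #76 ⟸ N3.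
One-token folds they enable (desk's pen): `stub_U1_letter := …F0P2pGR91NOfN3.u1ThetaDichotomy_nonsplit_of_N3 stub_N3_letter`,
`stub_thetaType_in_principalSeries := …F0P2pGR91NOfN3.stubThetaInPS_of_N3 stub_N3_letter`, `stub_GR91N := …F0P2pGR91NOfN3.GR91Lemma512NonsplitAsPrinted_of_N3 stub_N3_letter`.
No definition, no named fact, no instance, no notation, no `sorry`; every proof is a single application of ★ theorems BY NAME (syntactic
unification only; no `def` letter is unfolded).
HONEST LABEL: HC_CM is proved only modulo the 2 remaining named inputs (hLiu418, h413) until rung 0 closes; this file is CONDITIONAL on N3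
and proves nothing about HC_CM by itself.

## References
* [GelbartRogawski1991] S. Gelbart, J. Rogawski, Invent. Math. 105 (1991): §3.2 (3.2.1)–(3.2.3) p. 457; §5.1 (5.1.1) p. 465, Lemma 5.1.2 pp. 465–466.
* [Rogawski1990] J. Rogawski, Ann. of Math. Stud. 123 (1990): §12.1 p. 172, §12.2 (2) pp. 173–174.
* [Casselman1995] W. Casselman, *Introduction to the theory of admissible representations of p-adic reductive groups* (1995): Lemma 7.1.1 (a).
* [HarrisKudlaSweet1996] M. Harris, S. Kudla, W. J. Sweet, JAMS 9 (1996): Cor. 4.4.  [Kudla1986] Invent. Math. 83 (1986): Thm. 2.8.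
-/

set_option autoImplicit false
-- the mandated namespace has the single-problem summit's repeated segment (`HodgeConjecture.HodgeConjecture`)
set_option linter.dupNamespace false

noncomputable section

open NumberField IsDedekindDomain MeasureTheory
open scoped NNReal Pointwise

open Literature.NumberTheory Literature.NumberTheory.Automorphic Literature.NumberTheory.Automorphic.UnitaryGroup
open Literature.NumberTheory.Automorphic.IdeleClassGroup
open Literature.NumberTheory.Automorphic.Liu2021 Literature.NumberTheory.Automorphic.Liu2021.Def411WeilCarriers
open Literature.NumberTheory.GaloisRepresentations
open Literature.NumberTheory.Rogawski1990
open Literature.NumberTheory.GelbartRogawski1991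
open scoped Matrix

namespace Summit.HodgeConjecture.HodgeConjecture.Cruxes.H413.F0P2pGR91NOfN3

/-! ## §1 U1 (#97) from N3 alone -/

/-- **THE U1 LETTER ★ `GelbartRogawski1991.u1ThetaDichotomy_nonsplit` FROM N3 ALONE** (the `(U(1), U(1))` theta dichotomy at a non-split
place, [HarrisKudlaSweet1996, Cor. 4.4 (m = n = 1)]): road (T) ★ `u1ThetaDichotomy_nonsplit_of_uniqueSub (hN3) (h4)` with its second binder
— sub-uniqueness for `i_G(χ)`, `χ ≠ wχ`, on `U(Φ₃)(L⁺_v)` — discharged by ★ `principalSeries_uniqueSub` at the hypothesis-free N1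
★ `U3PrincipalSeriesJacquetFiltration_holds_of_lineAction L (torus_normalizedJacquet_openCellLine_eq_weylChar L)` ([Casselman1995,
Lemma 7.1.1 (a)]). [cite: HarrisKudlaSweet1996, Cor. 4.4] [cite: GelbartRogawski1991, §3.2 (3.2.1)–(3.2.2) p. 457] [cite: Casselman1995, Lemma 7.1.1 (a)] -/
theorem u1ThetaDichotomy_nonsplit_of_N3
    (hN3 : Literature.NumberTheory.GelbartRogawski1991.thetaType_nonsplit_jacquetModule) :
    Literature.NumberTheory.GelbartRogawski1991.u1ThetaDichotomy_nonsplit :=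
  F0P2oU1LetterOfTower.u1ThetaDichotomy_nonsplit_of_uniqueSub hN3
    (F0P2pPrincipalSeriesUniqueSubCM.principalSeries_uniqueSub fun L _ _ _ =>
      F0P3U3PrincipalSeriesJacquetFiltrationHolds.U3PrincipalSeriesJacquetFiltration_holds_of_lineAction L
        (F0P3U3PrincipalSeriesOpenCellTorusChar.torus_normalizedJacquet_openCellLine_eq_weylChar L))

/-! ## §2 The registered stub K1 of the parent line from N3 alone -/

set_option synthInstance.maxHeartbeats 400000 in
set_option maxHeartbeats 8000000 in
/-- **Stub K1 `StubThetaInPS` «THE THETA TYPE LIES IN THE PRINCIPAL SERIES» of `Cruxes/H413/Lines/F0_P2GR91NJacquet.lean` (:87–101, statement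
VERBATIM = ★ `stubThetaInPS_of_letters`'s conclusion), FROM N3 ALONE**: for the K1 data (CM frame, conjugate-symplectic `μ`, unitary continuous
`χ_f`, non-split `v`, form congruence) some line class `ε`, class `x₀` of `U(Φ₃)(L⁺_v)` and character `ψθ` of `E¹_v` satisfy the centre-character
constraint, `x₀` is a constituent of `i_G(χθ)`, `χθ = cmXiTorusChar L v μ_v ψθ⁻¹ ψθ`, and `x₀` transported along `congr_T` is the theta type
`ThetaTypeAtCM … ε v`.  Proof: ★ `stubThetaInPS_of_letters hN3 ‹K1w ★› ‹U1 ⟸ N3 (§1)›`. [cite: GelbartRogawski1991, §5.1 (5.1.1) p. 465, Lem. 5.1.2 pp. 465–466]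
[cite: Rogawski1990, §12.2 (2) p. 174] -/
theorem stubThetaInPS_of_N3
    (hN3 : Literature.NumberTheory.GelbartRogawski1991.thetaType_nonsplit_jacquetModule) :
  ∀ (L : Type) [Field L] [NumberField L] [IsCMField L] (H : Matrix (Fin 3) (Fin 3) L) (hH : (H.map (cmConjRingHom L))ᵀ = H) (hHd : IsUnit H.det)
    {n' : ℕ} (e₁ : Fin 3 × Fin 1 ≃ Fin n') (dV : Fin 3 → L) (hdV : ∀ i, IsCMField.complexConj L (dV i) = dV i) (hdV0 : ∀ i, dV i ≠ 0) (g : GL (Fin 3) L)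
    (hg : ((g : Matrix (Fin 3) (Fin 3) L).map (cmConjRingHom L))ᵀ * H * (g : Matrix (Fin 3) (Fin 3) L) = Matrix.diagonal dV),
    ∀ (μ : Literature.NumberTheory.Automorphic.IdeleClassGroup L →ₜ* Circle) (hμ : IsConjugateSymplectic L μ)
      (χf : UnitaryGroup.finAdelicOne (↥(maximalRealSubfield L)) L (IsCMField.complexConj L) →* ℂˣ),
      Continuous χf → (∀ z, ‖((χf z : ℂˣ) : ℂ)‖ = 1) →
      ∀ (v : HeightOneSpectrum (𝓞 ↥(maximalRealSubfield L))),
        (∀ w : PlacesOver L v, IsCMField.complexConj L • w.1 = w.1) →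
        ∀ (T : GL (Fin 3) (UnitaryGroup.LocalRing L v)) (a : UnitaryGroup.LocalRing L v) (ha : IsUnit a)
          (h : formCongr (conjLocal L (IsCMField.complexConj L) v) T (H.map (algebraMap L (UnitaryGroup.LocalRing L v))) =
            a • (Matrix.of fun i j : Fin 3 => if i.val + j.val + 1 = 3 then (1 : L) else 0).map (algebraMap L (UnitaryGroup.LocalRing L v))),
          ∃ (ε : (↥(maximalRealSubfield L))ˣ) (x₀ : IrrClass (Gqs L v)) (ψθ : ↥(normOneUnits (conjLocal L (IsCMField.complexConj L) v)) →* ℂˣ),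
            IsThetaCenterChar L μ χf ε v ψθ ∧
            x₀.IsConstituentOf (cmPrincipalSeries L 3 v (cmXiTorusChar L v ((toHeckeCharacter L μ).semilocalComponent L v) ψθ⁻¹ ψθ)) ∧
            ThetaTypeAtCM L H e₁ dV hdV hdV0 g hg μ hμ χf ε v (IrrClass.comap (cmDatumLocalCongr L v T ha h).symm x₀) :=
  F0P2oThetaInPSOfLetters.stubThetaInPS_of_letters hN3 F0P2pK1wHolds.cmPrincipalSeries_isConstituentOf_weylConj_holds
    (u1ThetaDichotomy_nonsplit_of_N3 hN3)

/-! ## §3 Print letter #76 (GR91 Lemma 5.1.2, non-split, as printed) from N3 alone -/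

/-- **PRINT LETTER #76 ★ `GelbartRogawski1991.GR91Lemma512NonsplitAsPrinted` FROM N3 ALONE**: at a non-split place the local Weil lift
`πⁿ(ξ_v)` is a constituent of the principal series named by the Gelbart–Rogawski dictionary ([GelbartRogawski1991, §5.1 (5.1.1), Lemma 5.1.2]).
Proof: ★ `F0P2oGR91NOfLetters.GR91N_of_letters hN3 ‹K1w ★ hypothesis-free› ‹U1 ⟸ N3 (§1)›` — so the PKΠ line's `stub_GR91N` and the parent
pay-down line are closed modulo the ONE print letter N3. [cite: GelbartRogawski1991, §5.1 (5.1.1) p. 465, Lem. 5.1.2 pp. 465–466]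
[cite: Rogawski1990, §12.2 (2) p. 174] [cite: Kudla1986, Thm. 2.8] -/
theorem GR91Lemma512NonsplitAsPrinted_of_N3
    (hN3 : Literature.NumberTheory.GelbartRogawski1991.thetaType_nonsplit_jacquetModule) :
    Literature.NumberTheory.GelbartRogawski1991.GR91Lemma512NonsplitAsPrinted :=
  F0P2oGR91NOfLetters.GR91N_of_letters hN3 F0P2pK1wHolds.cmPrincipalSeries_isConstituentOf_weylConj_holds
    (u1ThetaDichotomy_nonsplit_of_N3 hN3)

end Summit.HodgeConjecture.HodgeConjecture.Cruxes.H413.F0P2pGR91NOfN3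

end
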